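import Summits.QuantumFields.BalabanUV.Beta.GAN24.CombContactGaugeStaircaseCauchyHolds
import Summits.QuantumFields.BalabanUV.Beta.GAN24.ContactGaugeRefine

/-!
# `BalabanUV.Beta.GAN24.CombContactGaugeRefine` — binder row G-an2-4 ∕ (CONV-C), TRANSFER-III, the (III′) S-slot (b) of the END R `CombChargeRowsClosed`, the (III′) WILSON CONTACT
# RATE END `hCTd′`, step CT-4c AT THE COMB CHART: **THE CONJUGATED BOND GAUGE FUNCTION OF THE TALLER TOWER AT A FINE′ SITE AGAINST THE SHORTER TOWER's AT ITS CELL — ONE POINTWISE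
# LETTER, ONE RATE, NO HYPOTHESIS** — the (III′) twin of MY g61 (E) `ContactGaugeRefine.exists_gauge_refine_site_three`: MY `CombContactGaugeStaircaseCauchyHolds.exists_combGauge_staircase_cauchy`
# (clauses (v)∕(vi): the `(k+3)`-staircase `ΔG′` and its letters) SUMMED over the scales:
# `|λ′^{(0,k+1)} u′ − (Lc^4)⁻¹·λ′^{(0,k)} (blk Lc u′)| ≤ (3·α_d·θ^k·Lc^{k+2} + 2·α₀)·(Lc^{5(k+2)})⁻¹·e^{−κ‖quo (Lc^(k+2)) u′ − z‖∞}` — in units `N′^4 ×` (`N′ = Lc^{k+2}`): `3·α_d·θ^k + 2·α₀·N′⁻¹`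
# ((α) `θ`-small from the paired scales `2 … k+2` and the (E) part of scale `1`, (δ) `1∕N′`-small from the TWO unpaired finest pieces).

NOT IN PRINT; OUR BOOKKEEPING (G-an2-4 formalisation swarm, leaf prover `b2b-balaban-gan24-formalise-leaf-01`, gen 89; [folklore] one geometric sum over MY packaged CT-4b; 0 `def`, 0 cited facts,
0 `def … : Prop`, 0 sorry).  HONEST FRAMING (cell contract, verbatim): «discharging `BetaPertH` makes Bałaban's UV stability UNCONDITIONAL — a real constructive-QFT result; it is NOT the
continuum limit and NOT the Clay problem.»  HONEST DEPENDENCY (verbatim): «continuum YM on T⁴ ⇐ BetaPertH ∧ nine spine estimates (0/9 proved); BetaPertH ⇐ (D1) ∧ (D4) ∧ CAP+tail; G-an2-4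
gates asym, D1 and NE2/3/4.»  This is the `hdψ ∕ hdW` POINTWISE letter of leaf-02 g50's (E) `ContactCellRefine.abs_refine3_le ∕ ContactCellRefineTip.abs_refine3_tip_le` for SITE weights, for the
(III′) legs — consumed by the (III′) twins of `ContactRefineBUnits ∕ BThree ∕ BHolds` (successor work, `g89/S-SLOT-LETTERS-SIZING-g89.md` §1).  NO estimate of Bałaban's; discharges NOTHING of
`hCTd′` by itself; NEVER «G-an2-4 closed» as (CONV-C); NOT D1, NOT BetaPertH, NOT continuum, NOT Clay.  2026-08-28; no existing file touched.
-/

noncomputable section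

open Finset
open scoped BigOperators
open Literature.MathematicalPhysics.QuantumFieldTheory
open Literature.MathematicalPhysics.QuantumFieldTheory.LatticeForm (quo)
open Literature.MathematicalPhysics.QuantumFieldTheory.Balaban1983to89
open Literature.MathematicalPhysics.QuantumFieldTheory.Balaban1983to89.Beta
open B4ContourShift (supNorm supNorm_nonneg)
open AffineAveraging (Site box toSite)
open AveragingContours (blk)
open KKTFluctuationKernel (delta1)
open BalabanCompositeJets (respStep)
open Summit.QuantumFields.BalabanUV.Beta.AxialProjectorBlockMean (bmGaugeAt)
open Summit.QuantumFields.BalabanUV.Beta.SymCorrectorKernel (psiKS)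
open Summit.QuantumFields.BalabanUV.Beta.GAN24.RespStepBmDecompExact (respStepBmSeq)
open Summit.QuantumFields.BalabanUV.Beta.GAN24.RespStepBmDecompPsi (Psi)
open Summit.QuantumFields.BalabanUV.Beta.GAN24.StaircasePairing (sum_pow_le)
open Summit.QuantumFields.BalabanUV.Beta.GAN24.CombLegChainGauge (PsiFace)
open Summit.QuantumFields.BalabanUV.Beta.GAN24.CombContactGaugeStaircaseCauchyHolds (exists_combGauge_staircase_cauchy)

namespace Summit.QuantumFields.BalabanUV.Beta.GAN24.CombContactGaugeRefine

variable {Lc : ℕ} [NeZero Lc]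

/-! ## §1 Bookkeeping: the sum of the `k+3` piece letters -/

omit [NeZero Lc] in
/-- [folklore] **THE SUM OF THE (III′) PIECE LETTERS**: `Σ_{s′<k+3} (if s′ = 0 then A else if s′ = 1 then B·Lc + A else B·Lc^{s′}) ≤ 2·A + 3·B·Lc^{k+2}` for `B ≥ 0`, `Lc ≥ 2`
(`Σ_{2 ≤ s′ ≤ k+2} Lc^{s′} = Lc²·Σ_{s<k+1} Lc^s ≤ 2·Lc^{k+2}` by the OWNER's `StaircasePairing.sum_pow_le`, and `Lc ≤ Lc^{k+2}`). -/
theorem sum_pieceLetters_le (hLc : 2 ≤ Lc) (A : ℝ) {B : ℝ} (hB : 0 ≤ B) (k : ℕ) :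
    ∑ s' ∈ Finset.range (k + 2 + 1), (if s' = 0 then A else if s' = 1 then B * (Lc : ℝ) + A else B * (Lc : ℝ) ^ s')
      ≤ 2 * A + 3 * B * (Lc : ℝ) ^ (k + 2) := by
  have hL : (2 : ℝ) ≤ (Lc : ℝ) := by exact_mod_cast hLc
  have hL1 : (1 : ℝ) ≤ (Lc : ℝ) := by linarith
  have hL0 : (0 : ℝ) ≤ (Lc : ℝ) := by linarith
  rw [Finset.sum_range_succ' _ (k + 2), Finset.sum_range_succ' _ (k + 1)]
  simp only [Nat.succ_ne_zero, ↓reduceIte, zero_add, Nat.succ.injEq]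
  have hs : ∑ s ∈ Finset.range (k + 1), B * (Lc : ℝ) ^ (s + 1 + 1) = B * (Lc : ℝ) ^ 2 * ∑ s ∈ Finset.range (k + 1), (Lc : ℝ) ^ s := by
    rw [Finset.mul_sum]
    exact Finset.sum_congr rfl fun s _ => by ring
  have h := sum_pow_le hL k
  have h2 : B * (Lc : ℝ) ^ 2 * ∑ s ∈ Finset.range (k + 1), (Lc : ℝ) ^ s ≤ B * (Lc : ℝ) ^ 2 * (2 * (Lc : ℝ) ^ k) :=
    mul_le_mul_of_nonneg_left h (by positivity)
  have e : B * (Lc : ℝ) ^ 2 * (2 * (Lc : ℝ) ^ k) = 2 * B * (Lc : ℝ) ^ (k + 2) := by ring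
  have hpow : (Lc : ℝ) ≤ (Lc : ℝ) ^ (k + 2) := by
    calc (Lc : ℝ) = (Lc : ℝ) ^ 1 := (pow_one _).symm
      _ ≤ (Lc : ℝ) ^ (k + 2) := pow_le_pow_right₀ hL1 (by omega)
  have h3 : B * (Lc : ℝ) ≤ B * (Lc : ℝ) ^ (k + 2) := mul_le_mul_of_nonneg_left hpow hB
  rw [hs]
  linarith

/-! ## §2 `d = 3`: the pointwise site letter at one rate, no hypothesis -/

/-- NOT IN PRINT; OUR BOOKKEEPING ([folklore] packaging of MY `CombContactGaugeStaircaseCauchyHolds.exists_combGauge_staircase_cauchy` BY NAME, summed over the scales).  **THE CONJUGATED BOND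
GAUGE FUNCTIONS OF TWO CONSECUTIVE MEMBERS, TOP-ALIGNED, AGREE POINTWISE ON THE CELLS UP TO `θ^k + Lc^{−(k+2)}` (in units)** (`d = 3`, `m = 0`, every `Lc ≥ 2`, every root pair `r, rr ∈ box`):
ONE rate `κ > 0`, amplitudes `α₀, α_d ≥ 0`, ratio `0 ≤ θ < 1` with, for ALL `k μ z` and ALL fine′ sites `u′`,
`|λ′^{(0,k+1)} u′ − (Lc^4)⁻¹·λ′^{(0,k)} (blk Lc u′)| ≤ (3·α_d·θ^k·Lc^{k+2} + 2·α₀)·(Lc^{5(k+2)})⁻¹·e^{−κ‖quo (Lc^(k+2)) u′ − z‖∞}`,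
`λ′^{(0,k)} u = Psi ρ Lc 0 k (delta1 μ z) u + PsiFace r ρ Lc 0 k (delta1 μ z) u − bmGaugeAt ρ (respStep 1 (Lc^(k+1)) μ z) Lc u`. -/
theorem exists_combGauge_refine_site (hLc : 2 ≤ Lc) :
    ∃ κ α₀ αd θ : ℝ, 0 < κ ∧ 0 ≤ α₀ ∧ 0 ≤ αd ∧ 0 ≤ θ ∧ θ < 1 ∧
      ∀ (r : Fin (3 + 1) → ℕ), r ∈ box (3 + 1) Lc → ∀ (rr : Fin (3 + 1) → ℕ), rr ∈ box (3 + 1) Lc → ∀ (k : ℕ) (μ : Fin (3 + 1)) (z u' : Site (3 + 1)),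
        |(Psi (toSite rr) Lc 0 (k + 1) (delta1 μ z) u' + PsiFace r (toSite rr) Lc 0 (k + 1) (delta1 μ z) u'
              - bmGaugeAt (toSite rr) (respStep (d := 3) 1 (Lc ^ (k + 2)) μ z) Lc u')
            - ((Lc : ℝ) ^ (3 + 1))⁻¹ *
              (Psi (toSite rr) Lc 0 k (delta1 μ z) (blk Lc u') + PsiFace r (toSite rr) Lc 0 k (delta1 μ z) (blk Lc u')
                - bmGaugeAt (toSite rr) (respStep (d := 3) 1 (Lc ^ (k + 1)) μ z) Lc (blk Lc u'))|
          ≤ (3 * αd * θ ^ k * (Lc : ℝ) ^ (k + 2) + 2 * α₀) * ((Lc : ℝ) ^ (5 * (k + 2)))⁻¹ *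
            Real.exp (-(κ * supNorm (quo (Lc ^ (k + 2)) u' - z))) := by
  obtain ⟨κ, α₀, αd, θ, hκ, hα₀, hαd, hθ0, hθ1, H⟩ := exists_combGauge_staircase_cauchy (Lc := Lc) hLc
  refine ⟨κ, α₀, αd, θ, hκ, hα₀, hαd, hθ0, hθ1, fun r hr rr hrr k μ z u' => ?_⟩
  obtain ⟨-, -, -, -, hid, hlet⟩ := H r hr rr hrr k μ z
  rw [hid u']
  refine (Finset.abs_sum_le_sum_abs _ _).trans ?_
  refine (Finset.sum_le_sum fun s' hs' => hlet s' (by have h := Finset.mem_range.1 hs'; omega) u').trans ?_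
  rw [← Finset.sum_mul, ← Finset.sum_mul]
  have hB : 0 ≤ αd * θ ^ k := by positivity
  have hsum := sum_pieceLetters_le hLc α₀ hB k
  refine (mul_le_mul_of_nonneg_right (mul_le_mul_of_nonneg_right hsum (by positivity)) (Real.exp_pos _).le).trans (le_of_eq ?_)
  ring

end Summit.QuantumFields.BalabanUV.Beta.GAN24.CombContactGaugeRefine

end
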